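import Literature.Analysis.FluidPDE.CKNMorreyLemmasHolds
import Literature.Analysis.FluidPDE.CKNMorreyBootstrapDual
import Literature.Analysis.FluidPDE.MultiplierHeatKernelDecay
import Literature.Analysis.FluidPDE.CKNMorreyLemma136Holds
import HarnessLib

/-!
# Thm. 13.8 of Lemarié-Rieusset 2016 with `ε* = ε*(ν, τ₀, q₀)`: the assembly fed with the proved lemmas

Analysis/FluidPDE glue file (theorems only: no definition, no named fact, no `sorry`) for the
named fact `Literature.Analysis.FluidPDE.lemarieRieusset_ckn_criterion_qdep`
(`CKNMorreyLemmas.lean`: P. G. Lemarié-Rieusset, *The Navier–Stokes Problem in the 21st Century*,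
CRC Press 2016, Thm. 13.8 pp. 462–463 — the Caffarelli–Kohn–Nirenberg regularity criterion in
parabolic Morrey spaces — with the smallness constant depending on the pressure exponent, as the
printed proof, §13.9 pp. 466–478, delivers it: Lemma 13.4, p. 470, prints "`ε*` which depends only
on `ν, q₀, τ₀` and `τ₂`").

The accepted assembly `lemarieRieusset_ckn_criterion_qdep_of_lemmas` (`CKNMorreyLemmas.lean`;
§13.9 Step 4, "end of the proof", p. 477, with the reductions of p. 467) proves the criterion from
four named facts, three of which were theorems of the tree when this file was first written:

* `LemarieRieusset2016.pressure_localIntegrability_holds` ((13.19)–(13.21) p. 461;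
  `CKNMorreyLemmasHolds.lean`);
* `LemarieRieusset2016.lemma13_4_holds` (Lemma 13.4 p. 470, Kukavica's Morrey estimates;
  `CKNMorreyLemmasHolds.lean`, on Lemma 13.3 `CKNMorreyPressureEstimates.lean` and the iteration
  `CKNMorreyKukavica.lean`);
* `LemarieRieusset2016.lemma13_5_holds` (Lemma 13.5 p. 475; `CKNMorreyBootstrapDual.lean`);

while the fourth, Lemma 13.6 (p. 477), is reduced in the tree to Prop. 13.4 (proved:
`LemarieRieusset2016.prop13_4_holds`, `MultiplierHeatKernelDecay.lean`) and the single remaining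
named fact `LemarieRieusset2016.lemma13_6_duhamel` (`CKNMorreyHolder.lean`: the localised Duhamel
representation (13.50)–(13.52) with the Morrey classes of p. 478):
`LemarieRieusset2016.lemma13_6_of_duhamel_holds : lemma13_6_duhamel → lemma13_6`.

This file records the two resulting reductions of the criterion:

* `lemarieRieusset_ckn_criterion_qdep_of_lemma13_6 : lemma13_6 → lemarieRieusset_ckn_criterion_qdep`;
* `lemarieRieusset_ckn_criterion_qdep_of_duhamel :
    lemma13_6_duhamel → lemarieRieusset_ckn_criterion_qdep`,

so that the discharge of the criterion is the one-liner
`lemarieRieusset_ckn_criterion_qdep_of_duhamel lemma13_6_duhamel_holds` as soon as that last fact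
is proved (and the trunk corollaries follow through the accepted
`ckn_epsilon_regularity_of_exponent_of_qdep` / `ckn_epsilon_regularity_unforced_of_qdep`).

That last fact is now proved (`LemarieRieusset2016.lemma13_6_duhamel_holds`,
`CKNMorreyHolderProofs.lean`, whence `LemarieRieusset2016.lemma13_6_holds`,
`CKNMorreyLemma136Holds.lean`), and the file ends with the discharge itself:

* `lemarieRieusset_ckn_criterion_qdep_holds : lemarieRieusset_ckn_criterion_qdep` — Thm. 13.8 with
  `ε* = ε*(ν, τ₀, q₀)`, a theorem of the tree (axioms `propext`, `Classical.choice`, `Quot.sound`).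

## References

* P. G. Lemarié-Rieusset, *The Navier–Stokes Problem in the 21st Century*, CRC Press (2016),
  Thm. 13.8 (pp. 462–463); §13.9: p. 467, Lemma 13.4 (p. 470), Lemma 13.5 (p. 475), Step 4 and
  Lemma 13.6 (pp. 477–478). [LemarieRieusset2016]
-/

noncomputable section

namespace Literature.Analysis.FluidPDE

/-- **Thm. 13.8 (`q₀`-dependent constant) from Lemma 13.6 alone** (Lemarié-Rieusset 2016, §13.9
Step 4, p. 477: "We then end the proof with the lemma: Lemma 13.6"): the accepted assembly
`lemarieRieusset_ckn_criterion_qdep_of_lemmas` fed with the proved pressure localisation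
(13.19)–(13.21), the proved Lemma 13.4 and the proved Lemma 13.5. [cite: LemarieRieusset2016, §13.9 Step 4 p. 477] -/
theorem lemarieRieusset_ckn_criterion_qdep_of_lemma13_6 (h6 : LemarieRieusset2016.lemma13_6) :
    lemarieRieusset_ckn_criterion_qdep :=
  lemarieRieusset_ckn_criterion_qdep_of_lemmas
    LemarieRieusset2016.pressure_localIntegrability_holds LemarieRieusset2016.lemma13_4_holds
    LemarieRieusset2016.lemma13_5_holds h6

/-- **Thm. 13.8 (`q₀`-dependent constant) from the localised Duhamel representation
(13.50)–(13.52) alone** (Lemarié-Rieusset 2016, §13.9 Step 3 pp. 474–475 and the proof of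
Lemma 13.6 pp. 477–478: "and we apply Proposition 13.4"): Prop. 13.4 being proved
(`LemarieRieusset2016.prop13_4_holds`), Lemma 13.6 — and with it the whole criterion — depends on
the single named fact `LemarieRieusset2016.lemma13_6_duhamel`. [cite: LemarieRieusset2016, §13.9 pp. 474–478] -/
theorem lemarieRieusset_ckn_criterion_qdep_of_duhamel
    (hD : LemarieRieusset2016.lemma13_6_duhamel) : lemarieRieusset_ckn_criterion_qdep :=
  lemarieRieusset_ckn_criterion_qdep_of_lemma13_6
    (LemarieRieusset2016.lemma13_6_of_duhamel_holds hD)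

/-- **Lemarié-Rieusset 2016, Thm. 13.8 (the Caffarelli–Kohn–Nirenberg regularity criterion in
parabolic Morrey spaces, smallness constant `ε* = ε*(ν, τ₀, q₀)`), proved**: the named fact
`lemarieRieusset_ckn_criterion_qdep` of `CKNMorreyLemmas.lean` is a theorem. The proof is the
printed one (§13.9, pp. 466–478): the assembly `lemarieRieusset_ckn_criterion_qdep_of_lemmas`
(Step 4, "end of the proof", p. 477, with the reductions of p. 467) fed with the four proved
lemmas — the local integrability of the pressure (13.19)–(13.21)
(`LemarieRieusset2016.pressure_localIntegrability_holds`), Lemma 13.4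
(`LemarieRieusset2016.lemma13_4_holds`, on Lemma 13.3), Lemma 13.5
(`LemarieRieusset2016.lemma13_5_holds`) and Lemma 13.6 (`LemarieRieusset2016.lemma13_6_holds`, on
Prop. 13.4 and the localised Duhamel formula (13.50)–(13.52)). [cite: LemarieRieusset2016, Thm. 13.8 pp. 462–463; proof §13.9 pp. 466–478] -/
theorem lemarieRieusset_ckn_criterion_qdep_holds : lemarieRieusset_ckn_criterion_qdep :=
  lemarieRieusset_ckn_criterion_qdep_of_lemma13_6 LemarieRieusset2016.lemma13_6_holds

end Literature.Analysis.FluidPDE
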